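import Mathlib.LinearAlgebra.ExteriorPower.Basis
import Mathlib.LinearAlgebra.ExteriorAlgebra.Grading
import Mathlib.LinearAlgebra.Matrix.ToLin
import Mathlib.LinearAlgebra.FiniteDimensional.Basic
import Mathlib.RingTheory.Polynomial.Basic
import Mathlib.Order.Fin.Finset
import Mathlib.LinearAlgebra.LinearIndependent.Lemmas
import Literature.NumberTheory.Automorphic.RightTranslationGL
import HarnessLib

/-!
# Chevalley's theorem (Springer 5.5.3) on `k`-points: a closed subgroup is the stabiliser of a line
(trunk T-AUTOMORPHIC, G25 AutomorphicL; input of the theory of homogeneous spaces `G/H`, of Borel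
subgroups (6.2) and of the rank-one analysis 7.1.5/7.2.2 behind lang.S13 (b))

Companion to `RightTranslationGL.lean` (the representation `ρ` of `GL n k` on
`k[x_{ij}, det⁻¹]` by right translations, its degree-`≤ d` pieces `rTransRepDeg d`, and Springer
2.3.6: an algebraic subgroup is the stabiliser of its vanishing ideal,
`mem_of_rTransGL_vanishingIdeal`), in the concrete `k`-points vocabulary of
`LinearAlgebraicGroups.lean` (`IsAlgebraicSubgroup H` for `H ≤ GL n k`, coordinates `glCoordFun`).
Everything here is **proved**, over an arbitrary field `k`:

* `exists_span_vanIdealGL_inter_le_eq` (5.5.1, proof): `𝓘(H)` is generated by its elements of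
  degree `≤ d` for some `d` (Hilbert basis theorem);
* `idealDeg H d = W = 𝓘(H) ∩ V_d ⊆ V_d = k[x_{ij}, det⁻¹]_{≤ d}` and **Springer 5.5.1**
  (`mem_of_rTransRepDeg_idealDeg_le`, `rTransRepDeg_mem_idealDeg`): `H = {x | ρ(x) W = W}`;
* `exists_poly_coeff_rTransGL`, `exists_poly_linearForm_rTransRepDeg` (2.3.6 (ii)): the matrix
  coefficients of `ρ_d(x)` are polynomials in the coordinates of `x`;
* the exterior-algebra lemmas behind "*`L = ⋀ᵉ W` is a line and `x.L = L ⟺ x.W = W`*":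
  `ιMulti_ne_zero_of_linearIndependent`, the annihilator of a decomposable vector
  (`mem_span_iff_ι_mul_ιMulti_eq_zero`: `x ∈ ⟨w⟩ ⟺ x ∧ (w₁ ∧ … ∧ w_e) = 0`),
  `span_eq_of_ιMulti_eq_smul`, `exists_map_ιMulti_eq_smul_of_mapsTo`,
  `mapsTo_of_map_ιMulti_eq_smul` (Mathlib's `exteriorPower`: `ιMulti`, `map`,
  `Basis.exteriorPower`, `ιMultiDual_apply_ιMulti`, `ιMulti_family_linearIndependent_field`);
* `extRep`, `extRepGL d e : GL n k →* GL_N(k)` — the representation `⋀ᵉ ρ_d` in coordinates — with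
  **polynomial coordinates** (`exists_poly_glCoordFun_extRepGL`: entries are `e × e` minors of
  `ρ_d(x)`, and `det⁻¹` through `ρ(x⁻¹)`);
* **`exists_rep_lineStabilizer_eq` — Chevalley's theorem 5.5.3 on `k`-points**: for an algebraic
  `H ≤ GL n k` there are `N`, a homomorphism `ρ : GL n k → GL_N(k)` with polynomial coordinates
  and `v ∈ kᴺ ∖ {0}` such that `{x | ρ(x) v ∈ k v} = H`; and the relative form
  `exists_isAlgebraicGL_lineStabilizer_eq` for a subgroup `G ≤ GL n k`
  (`MonoidHom.IsAlgebraicGL (ρ|_G)`, stabiliser `G ∩ H`).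

Not vendored: the Lie-algebra half of 5.5.3 (`L(H) = {X ∈ 𝔤 | dφ(X) v ∈ k v}`), and the
quotient `G/H` itself (5.5.4–5.5.5).

## Mathlib

`MvPolynomial.restrictTotalDegree` (finite-dimensional, `basisRestrictSupport`),
`MvPolynomial.vanishingIdeal`, `Ideal.fg_of_isNoetherianRing`, the exterior powers
`⋀[K]^n M` (`exteriorPower.ιMulti`, `exteriorPower.map`, `Module.Basis.exteriorPower`,
`exteriorPower.ιMultiDual_apply_ιMulti`, `exteriorPower.ιMulti_family_linearIndependent_field`,
`ExteriorAlgebra.ιMulti_succ_apply`, `AlternatingMap.map_linearDependent`,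
`linearIndependent_finCons`), `LinearMap.toMatrix` (`toMatrix_mulVec_repr`),
`LinearMap.toMatrixAlgEquiv`, `MonoidHom.toHomUnits`, `RingHom.map_det`. Mathlib has no algebraic
groups and no form of Chevalley's theorem (searched `lineStabilizer`, `Chevalley` — only
Chevalley–Warning and constructibility —, `stabilizer` + `exteriorPower`).

## References

* [SpringerLAG1998] T. A. Springer, *Linear Algebraic Groups*, 2nd ed., Progress in Mathematics 9,
  Birkhäuser (1998): 2.3.6, 5.5.1, 5.5.3.
-/

open scoped MatrixGroups
open MvPolynomial exteriorPower

namespace Literature.NumberTheory.Automorphic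

variable {k : Type*} [Field k] {n : Type*} [Fintype n] [DecidableEq n]

/-! ### The ideal of an algebraic subgroup is generated in bounded degree -/

section BoundedDegree

variable (H : Subgroup (GL n k))

/-- The vanishing ideal `𝓘(H) ⊆ k[x_{ij}, det⁻¹]` of a subgroup `H ≤ GL n k` (Mathlib
`MvPolynomial.vanishingIdeal`), abbreviated locally. [folklore] -/
abbrev vanIdealGL : Ideal (MvPolynomial (GLCoord n) k) :=
  MvPolynomial.vanishingIdeal k (glCoordFun '' (H : Set (GL n k)))

/-- **`𝓘(H)` is generated by its elements of degree `≤ d` for some `d`** (Hilbert's basis theorem: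
`k[x_{ij}, det⁻¹]` is Noetherian; Springer 5.5.1, proof: "*let `f₁, …, f_r` generate the ideal …
take `d` larger than their degrees*"). [cite: SpringerLAG1998, 5.5.1 (proof)] -/
theorem exists_span_vanIdealGL_inter_le_eq :
    ∃ d : ℕ, Ideal.span ((vanIdealGL H : Set (MvPolynomial (GLCoord n) k)) ∩
      {p | p.totalDegree ≤ d}) = vanIdealGL H := by
  classical
  obtain ⟨s, hs⟩ := Ideal.fg_of_isNoetherianRing (vanIdealGL H)
  refine ⟨s.sup MvPolynomial.totalDegree, le_antisymm ?_ ?_⟩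
  · rw [Ideal.span_le]
    exact Set.inter_subset_left
  · rw [← hs, Ideal.span_le]
    intro p hp
    exact Ideal.subset_span ⟨hs ▸ Ideal.subset_span hp, Finset.le_sup (f := MvPolynomial.totalDegree) hp⟩

end BoundedDegree

/-! ### The stable subspace `W = 𝓘(H)_{≤ d}` and its stabiliser (Springer 5.5.1) -/

section Stabiliser

variable (H : Subgroup (GL n k)) (d : ℕ)

/-- The finite-dimensional `k`-space `V_d = k[x_{ij}, det⁻¹]_{≤ d}` of polynomials of total degree
`≤ d` (Mathlib `MvPolynomial.restrictTotalDegree`), on which `GL n k` acts by right translations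
(`rTransRepDeg d`, Springer 2.3.6). [folklore] -/
noncomputable abbrev PolyDeg (n : Type*) (k : Type*) [Field k] (d : ℕ) : Submodule k (MvPolynomial (GLCoord n) k) :=
  MvPolynomial.restrictTotalDegree (GLCoord n) k d

/-- The subspace `W = 𝓘(H) ∩ V_d` of `V_d` (Springer 5.5.1: "*`W = V ∩ I`*"). [cite: SpringerLAG1998, 5.5.1] -/
noncomputable def idealDeg : Submodule k ↥(PolyDeg n k d) where
  carrier := {p | (p : MvPolynomial (GLCoord n) k) ∈ vanIdealGL H}
  zero_mem' := (vanIdealGL H).zero_mem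
  add_mem' ha hb := (vanIdealGL H).add_mem ha hb
  smul_mem' c p hp := by
    change c • (p : MvPolynomial (GLCoord n) k) ∈ vanIdealGL H
    rw [MvPolynomial.smul_eq_C_mul]
    exact (vanIdealGL H).mul_mem_left _ hp

variable {H d}

/-- Membership in `idealDeg H d`. [folklore] -/
@[simp] lemma mem_idealDeg {p : ↥(PolyDeg n k d)} :
    p ∈ idealDeg H d ↔ (p : MvPolynomial (GLCoord n) k) ∈ vanIdealGL H := Iff.rfl

/-- `ρ(x) W ⊆ W` for `x ∈ H` (Springer 5.5.1: `I` and `V` are stable under `H`). [cite: SpringerLAG1998, 5.5.1] -/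
theorem rTransRepDeg_mem_idealDeg {x : GL n k} (hx : x ∈ H) {p : ↥(PolyDeg n k d)}
    (hp : p ∈ idealDeg H d) : rTransRepDeg d x p ∈ idealDeg H d := by
  rw [mem_idealDeg] at hp ⊢
  exact rTransGL_mem_vanishingIdeal hx hp

/-- **Springer 5.5.1: `H` is the stabiliser of `W = 𝓘(H)_{≤ d}`** once `𝓘(H)` is generated in
degree `≤ d`: if `ρ(x) W ⊆ W` then `ρ(x) 𝓘(H) ⊆ 𝓘(H)` (`ρ(x)` is an algebra endomorphism), so
`x ∈ H` (`mem_of_rTransGL_vanishingIdeal`, 2.3.6). [cite: SpringerLAG1998, 5.5.1] -/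
theorem mem_of_rTransRepDeg_idealDeg_le (hH : IsAlgebraicSubgroup H)
    (hd : Ideal.span ((vanIdealGL H : Set (MvPolynomial (GLCoord n) k)) ∩
      {p | p.totalDegree ≤ d}) = vanIdealGL H)
    {x : GL n k} (hx : ∀ p ∈ idealDeg H d, rTransRepDeg d x p ∈ idealDeg H d) : x ∈ H := by
  refine mem_of_rTransGL_vanishingIdeal hH fun q hq => ?_
  have hq' : q ∈ Ideal.span ((vanIdealGL H : Set (MvPolynomial (GLCoord n) k)) ∩
      {p | p.totalDegree ≤ d}) := by rw [hd]; exact hq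
  clear hq
  refine Submodule.span_induction (p := fun q _ => rTransGL x q ∈ vanIdealGL H) ?_ ?_ ?_ ?_ hq'
  · rintro p ⟨hpI, hpd⟩
    have h := hx ⟨p, (MvPolynomial.mem_restrictTotalDegree _ _ _).2 hpd⟩ hpI
    exact h
  · simp
  · intro p q _ _ hp hq
    rw [map_add]
    exact (vanIdealGL H).add_mem hp hq
  · intro a p _ hp
    rw [smul_eq_mul, map_mul]
    exact (vanIdealGL H).mul_mem_left _ hp

end Stabiliser

/-! ### Matrix coefficients of right translation are polynomial -/

section Polynomiality

/-- **The coefficients of `ρ(x) p` are polynomial functions of `x`**: for every polynomial `p`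
and monomial `m` there is a polynomial `P` in the coordinates with
`coeff_m (ρ(x) p) = P(x)` for all `x ∈ GL n k` (Springer 2.3.6 (ii): matrix coefficients of the
regular representation are regular functions). Induction on `p`; the substitution polynomials of
`ρ(x)` are linear in the variables with coefficients the coordinates `x i j`, `(det x)⁻¹` of `x`.
[cite: SpringerLAG1998, 2.3.6] -/
theorem exists_poly_coeff_rTransGL (p : MvPolynomial (GLCoord n) k) :
    ∀ m : GLCoord n →₀ ℕ, ∃ P : MvPolynomial (GLCoord n) k,
      ∀ x : GL n k, coeff m (rTransGL x p) = MvPolynomial.eval (glCoordFun x) P := by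
  classical
  induction p using MvPolynomial.induction_on with
  | C a =>
    intro m
    refine ⟨MvPolynomial.C (coeff m (MvPolynomial.C a : MvPolynomial (GLCoord n) k)), fun x => ?_⟩
    rw [rTransGL, MvPolynomial.bind₁_C_right, MvPolynomial.eval_C]
  | add p q hp hq =>
    intro m
    obtain ⟨P, hP⟩ := hp m
    obtain ⟨Q, hQ⟩ := hq m
    exact ⟨P + Q, fun x => by rw [map_add, coeff_add, hP, hQ, map_add]⟩
  | mul_X p c hp =>
    intro m
    rcases c with ⟨i, j⟩ | u
    · -- `ρ(x)(p X_{ij}) = ρ(x) p · ∑ₗ X_{il} x_{lj}`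
      choose P hP using hp
      refine ⟨∑ l : n, (if Sum.inl (i, l) ∈ m.support then
          P (m - Finsupp.single (Sum.inl (i, l)) 1) else 0) * MvPolynomial.X (Sum.inl (l, j)),
        fun x => ?_⟩
      rw [map_mul, rTransGL, MvPolynomial.bind₁_X_right, rTransPolyGL, Finset.mul_sum, coeff_sum,
        map_sum]
      refine Finset.sum_congr rfl fun l _ => ?_
      rw [← mul_assoc, mul_comm _ (MvPolynomial.C _), coeff_C_mul, coeff_mul_X', map_mul,
        MvPolynomial.eval_X, glCoordFun_inl, mul_comm]
      split_ifs with h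
      · rw [← rTransGL, hP]
      · simp
    · -- `ρ(x)(p det⁻¹) = ρ(x) p · det⁻¹ · (det x)⁻¹`
      choose P hP using hp
      refine ⟨(if Sum.inr u ∈ m.support then P (m - Finsupp.single (Sum.inr u) 1) else 0) *
        MvPolynomial.X (Sum.inr ()), fun x => ?_⟩
      rw [map_mul, rTransGL, MvPolynomial.bind₁_X_right, rTransPolyGL, ← mul_assoc,
        mul_comm _ (MvPolynomial.C _), coeff_C_mul, map_mul, MvPolynomial.eval_X, glCoordFun_inr,
        mul_comm]
      rcases u with ⟨⟩
      rw [coeff_mul_X']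
      split_ifs with h
      · rw [← rTransGL, hP]
      · simp

/-- For `p ∈ V_d` and a linear functional `ℓ` on `V_d`, **`x ↦ ℓ(ρ(x) p)` is a polynomial function
of `x`** (the coordinates of `ρ(x) p` in the monomial basis are coefficients). [cite: SpringerLAG1998, 2.3.6] -/
theorem exists_poly_linearForm_rTransRepDeg {d : ℕ} (ℓ : ↥(PolyDeg n k d) →ₗ[k] k)
    (p : ↥(PolyDeg n k d)) :
    ∃ P : MvPolynomial (GLCoord n) k,
      ∀ x : GL n k, ℓ (rTransRepDeg d x p) = MvPolynomial.eval (glCoordFun x) P := by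
  classical
  -- expand in the monomial basis of `V_d`
  set s : Set (GLCoord n →₀ ℕ) := {m | m.sum (fun _ e => e) ≤ d} with hs
  let b : Module.Basis ↑s k ↥(PolyDeg n k d) := MvPolynomial.basisRestrictSupport k s
  haveI : Finite ↑s := Module.Finite.finite_basis b
  haveI : Fintype ↑s := Fintype.ofFinite _
  have hrepr : ∀ (q : ↥(PolyDeg n k d)) (m : ↑s), b.repr q m = coeff m.1 (q : MvPolynomial (GLCoord n) k) := by
    intro q m
    simp [b, MvPolynomial.basisRestrictSupport]
    rfl
  choose P hP using fun m : ↑s => exists_poly_coeff_rTransGL (p : MvPolynomial (GLCoord n) k) m.1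
  refine ⟨∑ m : ↑s, MvPolynomial.C (ℓ (b m)) * P m, fun x => ?_⟩
  have hexp : rTransRepDeg d x p = ∑ m : ↑s, (b.repr (rTransRepDeg d x p) m) • b m :=
    (b.sum_repr _).symm
  rw [hexp, map_sum, map_sum]
  refine Finset.sum_congr rfl fun m _ => ?_
  rw [map_smul, smul_eq_mul, map_mul, MvPolynomial.eval_C, hrepr, ← hP m x, mul_comm]
  rfl

end Polynomiality

/-! ### Decomposable vectors: the line `⋀ᵉ W ⊂ ⋀ᵉ V` determines `W` -/

section ExteriorLine

variable {K V : Type*} [Field K] [AddCommGroup V] [Module K V]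

/-- The order embedding `Fin e ↪o Fin e` attached to the full subset is the identity. [folklore] -/
lemma powersetCard_ofFinEmbEquiv_symm_univ (e : ℕ) (h : (Finset.univ : Finset (Fin e)) ∈ Set.powersetCard (Fin e) e) :
    (Set.powersetCard.ofFinEmbEquiv.symm ⟨Finset.univ, h⟩ : Fin e ↪o Fin e) =
      (OrderIso.refl (Fin e)).toOrderEmbedding := by
  rw [Set.powersetCard.ofFinEmbEquiv_symm_apply]
  exact (Finset.orderEmbOfFin_unique' _ fun x => Finset.mem_univ _).symm

/-- **A linearly independent `e`-tuple has non-zero exterior product** (the `e`-fold products of a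
linearly independent family are linearly independent, Mathlib
`exteriorPower.ιMulti_family_linearIndependent_field`). [folklore] -/
theorem ιMulti_ne_zero_of_linearIndependent {e : ℕ} {w : Fin e → V} (hw : LinearIndependent K w) :
    ExteriorAlgebra.ιMulti K e w ≠ 0 := by
  have hmem : (Finset.univ : Finset (Fin e)) ∈ Set.powersetCard (Fin e) e := by
    simp [Set.powersetCard]
  have hli := exteriorPower.ιMulti_family_linearIndependent_field e hw
  have hne := hli.ne_zero ⟨Finset.univ, hmem⟩
  rw [ιMulti_family, powersetCard_ofFinEmbEquiv_symm_univ] at hne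
  intro h0
  apply hne
  apply Subtype.ext
  simpa using h0

/-- `ιMulti (x, w₁, …, w_e) = ι(x) · ιMulti (w₁, …, w_e)` in the exterior algebra. [folklore] -/
lemma ιMulti_cons {e : ℕ} (x : V) (w : Fin e → V) :
    ExteriorAlgebra.ιMulti K (e + 1) (Fin.cons x w) = ExteriorAlgebra.ι K x * ExteriorAlgebra.ιMulti K e w := by
  rw [ExteriorAlgebra.ιMulti_succ_apply]
  congr 2

/-- **The annihilator of a decomposable vector**: for a linearly independent `e`-tuple `w` and
`ω = w₁ ∧ … ∧ w_e`, a vector `x` lies in the span of `w` iff `x ∧ ω = 0`. [folklore] -/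
theorem mem_span_iff_ι_mul_ιMulti_eq_zero {e : ℕ} {w : Fin e → V} (hw : LinearIndependent K w)
    (x : V) :
    x ∈ Submodule.span K (Set.range w) ↔
      ExteriorAlgebra.ι K x * ExteriorAlgebra.ιMulti K e w = 0 := by
  constructor
  · intro hx
    have hdep : ¬ LinearIndependent K (Fin.cons x w : Fin (e + 1) → V) := by
      rw [linearIndependent_finCons]
      exact fun h => h.2 hx
    have h0 := AlternatingMap.map_linearDependent (ExteriorAlgebra.ιMulti K (e + 1)) _ hdep
    rwa [ιMulti_cons] at h0
  · intro h0
    by_contra hx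
    have hli : LinearIndependent K (Fin.cons x w : Fin (e + 1) → V) :=
      linearIndependent_finCons.2 ⟨hw, hx⟩
    exact ιMulti_ne_zero_of_linearIndependent hli (by rw [ιMulti_cons, h0])

/-- **Proportional decomposable vectors have the same span**: if `w, w'` are linearly independent
`e`-tuples with `w'₁ ∧ … ∧ w'_e = c · (w₁ ∧ … ∧ w_e)`, then `span w' = span w` (and `c ≠ 0`).
[folklore] -/
theorem span_eq_of_ιMulti_eq_smul {e : ℕ} {w w' : Fin e → V} (hw : LinearIndependent K w)
    (hw' : LinearIndependent K w') {c : K}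
    (h : ExteriorAlgebra.ιMulti K e w' = c • ExteriorAlgebra.ιMulti K e w) :
    Submodule.span K (Set.range w') = Submodule.span K (Set.range w) := by
  have hc : c ≠ 0 := by
    rintro rfl
    rw [zero_smul] at h
    exact ιMulti_ne_zero_of_linearIndependent hw' h
  ext x
  rw [mem_span_iff_ι_mul_ιMulti_eq_zero hw', mem_span_iff_ι_mul_ιMulti_eq_zero hw, h,
    mul_smul_comm, smul_eq_zero_iff_right hc]

variable {e : ℕ} (W : Submodule K V) (bW : Module.Basis (Fin e) K ↥W)

/-- The `e`-tuple of `V` underlying a basis of the `e`-dimensional subspace `W`. [folklore] -/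
noncomputable abbrev tupleOf : Fin e → V := fun i => (bW i : V)

/-- The tuple of a basis of `W` is linearly independent in `V`. [folklore] -/
lemma linearIndependent_tupleOf : LinearIndependent K (tupleOf W bW) :=
  bW.linearIndependent.map' W.subtype (Submodule.ker_subtype W)

/-- The tuple of a basis of `W` spans `W`. [folklore] -/
lemma span_range_tupleOf : Submodule.span K (Set.range (tupleOf W bW)) = W := by
  have h1 : Set.range (tupleOf W bW) = W.subtype '' Set.range bW := by
    rw [← Set.range_comp]; rfl
  rw [h1, Submodule.span_image, bW.span_eq, Submodule.map_top, Submodule.range_subtype]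

/-- **If `f(W) ⊆ W` then `f` preserves the line of `w₁ ∧ … ∧ w_e`** (`w` a basis of `W`):
`⋀ᵉ f (w₁ ∧ … ∧ w_e) ∈ ⋀ᵉ W = K · (w₁ ∧ … ∧ w_e)` (Springer 5.5.3, proof: "*Let `V = ⋀ᵉ A`,
`L = ⋀ᵉ M` … if `x.M = M` then `x.L = L`*"). [cite: SpringerLAG1998, 5.5.3 (proof)] -/
theorem exists_map_ιMulti_eq_smul_of_mapsTo (f : V →ₗ[K] V) (hf : ∀ x ∈ W, f x ∈ W) :
    ∃ c : K, exteriorPower.map e f (ιMulti K e (tupleOf W bW)) = c • ιMulti K e (tupleOf W bW) := by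
  -- restrict `f` to `W` and compute inside `⋀ᵉ W`, which is a line
  set fW : ↥W →ₗ[K] ↥W := f.restrict (p := W) (q := W) hf with hfW
  have hmem : (Finset.univ : Finset (Fin e)) ∈ Set.powersetCard (Fin e) e := by
    simp [Set.powersetCard]
  set s₀ : ↑(Set.powersetCard (Fin e) e) := ⟨Finset.univ, hmem⟩ with hs₀
  have huniq : ∀ s : ↑(Set.powersetCard (Fin e) e), s = s₀ := by
    intro s
    apply Subtype.ext
    have hs := s.2
    simp only [Set.powersetCard, Set.mem_setOf_eq] at hs
    exact Finset.eq_univ_of_card _ (by simp [hs])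
  let bΛ := bW.exteriorPower e
  have hbΛ : bΛ s₀ = ιMulti K e (fun i => bW i) := by
    rw [show bΛ s₀ = ιMulti_family K e bW s₀ from by rw [exteriorPower.coe_basis]]
    rw [ιMulti_family, hs₀, powersetCard_ofFinEmbEquiv_symm_univ]
    rfl
  -- every element of `⋀ᵉ W` is a multiple of `bΛ s₀`
  have hline : ∀ y : ↥(⋀[K]^e ↥W), y = (bΛ.repr y s₀) • bΛ s₀ := by
    intro y
    conv_lhs => rw [← bΛ.sum_repr y]
    rw [Finset.sum_eq_single s₀]
    · intro s _ hs; exact absurd (huniq s) hs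
    · intro h; exact absurd (Finset.mem_univ _) h
  set y := ιMulti K e (fun i => fW (bW i)) with hy
  obtain ⟨c₀, hc₀⟩ : ∃ c₀ : K, y = c₀ • bΛ s₀ := ⟨_, hline y⟩
  refine ⟨c₀, ?_⟩
  have h1 : ιMulti K e (tupleOf W bW) = exteriorPower.map e W.subtype (ιMulti K e (fun i => bW i)) := by
    rw [exteriorPower.map_apply_ιMulti]; rfl
  have h2 : exteriorPower.map e f (ιMulti K e (tupleOf W bW)) =
      exteriorPower.map e W.subtype y := by
    rw [exteriorPower.map_apply_ιMulti, hy, exteriorPower.map_apply_ιMulti]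
    rfl
  rw [h2, hc₀, map_smul, hbΛ, ← h1]

/-- **Conversely, if `⋀ᵉ f` preserves the line of `w₁ ∧ … ∧ w_e` (`w` a basis of `W`, `f`
injective) then `f(W) ⊆ W`** (Springer 5.5.3, proof: "*It follows that the `x.mᵢ` also form a
basis of `M`, whence `x.M = M`*"): `f(w₁) ∧ … ∧ f(w_e) = c (w₁ ∧ … ∧ w_e)` with `c ≠ 0`, and a
non-zero decomposable vector determines its span (`span_eq_of_ιMulti_eq_smul`).
[cite: SpringerLAG1998, 5.5.3 (proof)] -/
theorem mapsTo_of_map_ιMulti_eq_smul (f : V →ₗ[K] V) (hfi : Function.Injective f) {c : K}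
    (h : exteriorPower.map e f (ιMulti K e (tupleOf W bW)) = c • ιMulti K e (tupleOf W bW)) :
    ∀ x ∈ W, f x ∈ W := by
  have hw := linearIndependent_tupleOf W bW
  have hw' : LinearIndependent K (f ∘ tupleOf W bW) := hw.map' f (LinearMap.ker_eq_bot.2 hfi)
  rw [exteriorPower.map_apply_ιMulti] at h
  have h' : ExteriorAlgebra.ιMulti K e (f ∘ tupleOf W bW) =
      c • ExteriorAlgebra.ιMulti K e (tupleOf W bW) := by
    simpa using congrArg Subtype.val h
  have hspan := span_eq_of_ιMulti_eq_smul hw hw' h'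
  rw [span_range_tupleOf] at hspan
  intro x hx
  rw [← span_range_tupleOf W bW] at hx
  have hx' := Submodule.mem_map_of_mem (f := f) hx
  rwa [← Submodule.span_image, ← Set.range_comp, hspan] at hx'

end ExteriorLine


/-! ### Chevalley's theorem 5.5.3 on `k`-points: the line stabiliser representation -/

section Chevalley

variable (d e : ℕ)

/-- The representation `x ↦ ⋀ᵉ ρ_d(x)` of `GL n k` on `⋀ᵉ V_d` (`V_d = k[x_{ij}, det⁻¹]_{≤ d}` with
the right-translation action `rTransRepDeg d`), as a monoid homomorphism into the endomorphisms
(Springer 5.5.3, proof: "*`x ↦ ⋀ᵉ(φ x)` defines a rational representation `G → GL(V)`*").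
[cite: SpringerLAG1998, 5.5.3 (proof)] -/
noncomputable def extRep : GL n k →* Module.End k ↥(⋀[k]^e ↥(PolyDeg n k d)) where
  toFun x := exteriorPower.map e (rTransRepDeg d x)
  map_one' := by
    rw [map_one]
    exact exteriorPower.map_id
  map_mul' x y := by
    rw [map_mul]
    exact exteriorPower.map_comp _ _

/-- `extRep d e x = ⋀ᵉ (ρ_d x)`. [folklore] -/
@[simp] lemma extRep_apply (x : GL n k) : extRep d e x = exteriorPower.map e (rTransRepDeg d x) := rfl

/-- The dimension of `V_d`. [folklore] -/
noncomputable abbrev dimDeg (n : Type*) [Fintype n] [DecidableEq n] (k : Type*) [Field k] (d : ℕ) : ℕ :=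
  Module.finrank k ↥(PolyDeg n k d)

/-- A basis of `V_d` indexed by `Fin`. [folklore] -/
noncomputable def basisDeg : Module.Basis (Fin (dimDeg n k d)) k ↥(PolyDeg n k d) :=
  Module.finBasis k _

/-- The size of the induced basis of `⋀ᵉ V_d`. [folklore] -/
noncomputable abbrev dimExt (n : Type*) [Fintype n] [DecidableEq n] (k : Type*) [Field k] (d e : ℕ) : ℕ :=
  Fintype.card ↑(Set.powersetCard (Fin (dimDeg n k d)) e)

/-- The basis `e_{s}` (`s` an `e`-subset) of `⋀ᵉ V_d` induced by `basisDeg`, reindexed by `Fin`. [folklore] -/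
noncomputable def basisExt : Module.Basis (Fin (dimExt n k d e)) k ↥(⋀[k]^e ↥(PolyDeg n k d)) :=
  ((basisDeg (n := n) (k := k) d).exteriorPower e).reindex (Fintype.equivFin _)

/-- The matrix form `ρ : GL n k → GL_N(k)` of `x ↦ ⋀ᵉ ρ_d(x)` in the basis `basisExt`
(Springer 5.5.3). [cite: SpringerLAG1998, 5.5.3 (proof)] -/
noncomputable def extRepGL : GL n k →* GL (Fin (dimExt n k d e)) k :=
  ((LinearMap.toMatrixAlgEquiv (basisExt (n := n) (k := k) d e)).toMonoidHom.comp (extRep d e)).toHomUnits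

/-- The matrix of `extRepGL d e x` is the matrix of `⋀ᵉ ρ_d(x)` in the basis `basisExt`. [folklore] -/
lemma coe_extRepGL (x : GL n k) :
    ((extRepGL d e x : GL (Fin (dimExt n k d e)) k) : Matrix (Fin (dimExt n k d e)) (Fin (dimExt n k d e)) k) =
      LinearMap.toMatrix (basisExt d e) (basisExt d e) (extRep d e x) := rfl

/-- **The entries of `ρ(x) = ⋀ᵉ ρ_d(x)` are polynomial in `x`**: they are `e × e` minors of the
matrix of `ρ_d(x)` (Mathlib `exteriorPower.ιMultiDual_apply_ιMulti`), whose entries are polynomial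
(`exists_poly_linearForm_rTransRepDeg`). [cite: SpringerLAG1998, 5.5.3 (proof)] -/
theorem exists_poly_entry_extRepGL (i j : Fin (dimExt n k d e)) :
    ∃ P : MvPolynomial (GLCoord n) k, ∀ x : GL n k,
      ((extRepGL d e x : GL (Fin (dimExt n k d e)) k) : Matrix (Fin (dimExt n k d e)) (Fin (dimExt n k d e)) k) i j =
        MvPolynomial.eval (glCoordFun x) P := by
  classical
  set bV := basisDeg (n := n) (k := k) d with hbV
  set σ := (Fintype.equivFin ↑(Set.powersetCard (Fin (dimDeg n k d)) e)).symm with hσ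
  -- the entries of the minor
  set ri : Fin e → Fin (dimDeg n k d) := fun c => Set.powersetCard.ofFinEmbEquiv.symm (σ i) c
  set rj : Fin e → Fin (dimDeg n k d) := fun a => Set.powersetCard.ofFinEmbEquiv.symm (σ j) a
  choose Q hQ using fun (a c : Fin e) =>
    exists_poly_linearForm_rTransRepDeg (bV.coord (ri c)) (bV (rj a))
  refine ⟨(Matrix.of fun a c => Q a c).det, fun x => ?_⟩
  rw [coe_extRepGL, LinearMap.toMatrix_apply, basisExt, Module.Basis.repr_reindex_apply,
    Module.Basis.reindex_apply, exteriorPower.basis_repr_apply, exteriorPower.coe_basis,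
    exteriorPower.ιMulti_family, extRep_apply, exteriorPower.map_apply_ιMulti,
    exteriorPower.ιMultiDual_apply_ιMulti, RingHom.map_det]
  congr 1
  ext a c
  simp only [Matrix.of_apply, RingHom.mapMatrix_apply, Matrix.map_apply, Function.comp_apply]
  exact hQ a c x

/-- **All coordinates of `ρ(x)` (entries and `det⁻¹`) are polynomial in `x`**: `ρ = extRepGL d e` is
a homomorphism of algebraic groups `GL n → GL_N` (for `det(ρ x)⁻¹ = det(ρ x⁻¹)` use the
polynomiality of inversion, `eval_invPolyGL`). [cite: SpringerLAG1998, 5.5.3 (proof)] -/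
theorem exists_poly_glCoordFun_extRepGL :
    ∃ P : GLCoord (Fin (dimExt n k d e)) → MvPolynomial (GLCoord n) k,
      ∀ (x : GL n k) (c : GLCoord (Fin (dimExt n k d e))),
        glCoordFun (extRepGL d e x) c = MvPolynomial.eval (glCoordFun x) (P c) := by
  classical
  choose P hP using exists_poly_entry_extRepGL (n := n) (k := k) d e
  -- the determinant of `ρ(x⁻¹)` as a polynomial in `x`
  set Pdet : MvPolynomial (GLCoord n) k :=
    MvPolynomial.bind₁ invPolyGL (Matrix.of fun i j => P i j).det with hPdet
  refine ⟨fun c => match c with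
    | Sum.inl ij => P ij.1 ij.2
    | Sum.inr _ => Pdet, fun x c => ?_⟩
  rcases c with ⟨i, j⟩ | u
  · exact hP i j x
  · rw [glCoordFun_inr]
    rw [hPdet, eval_bind₁]
    have hinv : (fun c => MvPolynomial.eval (glCoordFun x) (invPolyGL c)) = glCoordFun x⁻¹ :=
      funext fun c => eval_invPolyGL x c
    rw [hinv, RingHom.map_det]
    have hmat : (MvPolynomial.eval (glCoordFun x⁻¹)).mapMatrix (Matrix.of fun i j => P i j) =
        ((extRepGL d e x⁻¹ : GL (Fin (dimExt n k d e)) k) : Matrix (Fin (dimExt n k d e)) (Fin (dimExt n k d e)) k) := by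
      ext i j
      simp only [RingHom.mapMatrix_apply, Matrix.map_apply, Matrix.of_apply]
      exact (hP i j x⁻¹).symm
    rw [hmat, map_inv, Matrix.coe_units_inv, Matrix.det_nonsing_inv, Ring.inverse_eq_inv']

variable (H : Subgroup (GL n k)) {d e}

/-- The vector `v = w₁ ∧ … ∧ w_e ∈ ⋀ᵉ V_d` attached to a basis `w` of `W = 𝓘(H)_{≤ d}`
(Springer 5.5.3: "*`L = ⋀ᵉ M`*"), in coordinates. [cite: SpringerLAG1998, 5.5.3 (proof)] -/
noncomputable def lineVec (bW : Module.Basis (Fin e) k ↥(idealDeg H d)) : Fin (dimExt n k d e) → k :=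
  ⇑((basisExt d e).repr (exteriorPower.ιMulti k e (tupleOf (idealDeg H d) bW)))

/-- `v ≠ 0`. [folklore] -/
theorem lineVec_ne_zero (bW : Module.Basis (Fin e) k ↥(idealDeg H d)) : lineVec H bW ≠ 0 := by
  intro h0
  have h1 : exteriorPower.ιMulti k e (tupleOf (idealDeg H d) bW) = 0 := by
    apply (basisExt (n := n) (k := k) d e).repr.injective
    rw [map_zero]
    exact DFunLike.coe_injective (by simpa [lineVec] using h0)
  have h2 := ιMulti_ne_zero_of_linearIndependent (linearIndependent_tupleOf (idealDeg H d) bW)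
  exact h2 (by simpa using congrArg Subtype.val h1)

/-- `ρ_d(x)` is injective on `V_d` (it is invertible, `ρ_d` being a representation of a group). [folklore] -/
lemma rTransRepDeg_injective (x : GL n k) : Function.Injective (rTransRepDeg (n := n) (k := k) d x) := by
  intro p q hpq
  have h := congrArg (rTransRepDeg d x⁻¹) hpq
  rwa [← Module.End.mul_apply, ← map_mul, inv_mul_cancel, map_one, Module.End.one_apply,
    ← Module.End.mul_apply, ← map_mul, inv_mul_cancel, map_one, Module.End.one_apply] at h

/-- **The line stabiliser condition in coordinates**: `ρ(x) v ∈ k v` iff `⋀ᵉ ρ_d(x)` preserves the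
line of `w₁ ∧ … ∧ w_e`, iff `ρ_d(x) W ⊆ W`. [cite: SpringerLAG1998, 5.5.3 (proof)] -/
theorem exists_mulVec_lineVec_eq_smul_iff (bW : Module.Basis (Fin e) k ↥(idealDeg H d)) (x : GL n k) :
    (∃ c : k, Matrix.mulVec ((extRepGL d e x : GL (Fin (dimExt n k d e)) k) : Matrix (Fin (dimExt n k d e)) (Fin (dimExt n k d e)) k) (lineVec H bW) =
        c • lineVec H bW) ↔
      ∀ p ∈ idealDeg H d, rTransRepDeg d x p ∈ idealDeg H d := by
  set v := exteriorPower.ιMulti k e (tupleOf (idealDeg H d) bW) with hv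
  have key : ∀ c : k, (Matrix.mulVec ((extRepGL d e x : GL (Fin (dimExt n k d e)) k) : Matrix (Fin (dimExt n k d e)) (Fin (dimExt n k d e)) k) (lineVec H bW) =
      c • lineVec H bW) ↔ exteriorPower.map e (rTransRepDeg d x) v = c • v := by
    intro c
    rw [lineVec, coe_extRepGL, LinearMap.toMatrix_mulVec_repr, extRep_apply, ← hv]
    constructor
    · intro h
      apply (basisExt (n := n) (k := k) d e).repr.injective
      rw [map_smul]
      exact DFunLike.coe_injective (by simpa using h)
    · intro h
      rw [h, map_smul]
      rfl
  simp only [key]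
  constructor
  · rintro ⟨c, hc⟩
    exact mapsTo_of_map_ιMulti_eq_smul (idealDeg H d) bW _ (rTransRepDeg_injective x) hc
  · intro h
    exact exists_map_ιMulti_eq_smul_of_mapsTo (idealDeg H d) bW _ h

/-- **Chevalley's theorem (Springer 5.5.3) on `k`-points.** *Let `H` be a closed subgroup of the
linear algebraic group `GL n`. There exist a rational representation `ρ : GL n → GL(V)` and a
non-zero `v ∈ V` such that `H = {x | ρ(x) v ∈ k v}`* — here for an algebraic subgroup
`H ≤ GL n k` (`IsAlgebraicSubgroup`) over any field `k`: a homomorphism `ρ : GL n k → GL_N(k)` all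
of whose coordinates are polynomials in the coordinates `x i j, (det x)⁻¹`, and `v ∈ kᴺ`, `v ≠ 0`,
whose line has stabiliser exactly `H`. Construction (5.5.1, 5.5.3): `V_d = k[x_{ij}, det⁻¹]_{≤ d}`
with `d` such that `W = 𝓘(H)_{≤ d}` generates `𝓘(H)`, `H = Stab(W)` (2.3.6), `V = ⋀ᵉ V_d`,
`v = ⋀ᵉ W`. Springer's statement for a closed subgroup `H` of a general linear algebraic group `G`
follows by restricting `ρ` to `G ≤ GL n`; the Lie-algebra half of 5.5.3
(`L(H) = {X | dφ(X) v ∈ k v}`) is **not** vendored here. [cite: SpringerLAG1998, Thm 5.5.3] -/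
theorem exists_rep_lineStabilizer_eq (hH : IsAlgebraicSubgroup H) :
    ∃ (N : ℕ) (ρ : GL n k →* GL (Fin N) k) (P : GLCoord (Fin N) → MvPolynomial (GLCoord n) k)
      (v : Fin N → k),
      (∀ (x : GL n k) (c : GLCoord (Fin N)), glCoordFun (ρ x) c = MvPolynomial.eval (glCoordFun x) (P c)) ∧
      v ≠ 0 ∧
      ∀ x : GL n k, (∃ c : k, Matrix.mulVec ((ρ x : GL (Fin N) k) : Matrix (Fin N) (Fin N) k) v = c • v) ↔ x ∈ H := by
  obtain ⟨d, hd⟩ := exists_span_vanIdealGL_inter_le_eq H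
  haveI : Module.Free k ↥(idealDeg H d) := Module.Free.of_divisionRing k ↥(idealDeg H d)
  set e := Module.finrank k ↥(idealDeg H d) with he
  set bW : Module.Basis (Fin e) k ↥(idealDeg H d) := Module.finBasis k _
  obtain ⟨P, hP⟩ := exists_poly_glCoordFun_extRepGL (n := n) (k := k) d e
  refine ⟨dimExt n k d e, extRepGL d e, P, lineVec H bW, hP, lineVec_ne_zero H bW, fun x => ?_⟩
  rw [exists_mulVec_lineVec_eq_smul_iff]
  exact ⟨mem_of_rTransRepDeg_idealDeg_le hH hd, fun hx p hp => rTransRepDeg_mem_idealDeg hx hp⟩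

/-- **Chevalley's theorem 5.5.3 relative to a subgroup `G ≤ GL n k`** (the form used for a closed
subgroup `H` of a linear algebraic group `G`): an algebraic homomorphism `ρ : G → GL_N(k)`
(`MonoidHom.IsAlgebraicGL`) and `v ≠ 0` with `{g ∈ G | ρ(g) v ∈ k v} = G ∩ H`.
[cite: SpringerLAG1998, Thm 5.5.3] -/
theorem exists_isAlgebraicGL_lineStabilizer_eq (G : Subgroup (GL n k)) (hH : IsAlgebraicSubgroup H) :
    ∃ (N : ℕ) (ρ : ↥G →* GL (Fin N) k) (v : Fin N → k), MonoidHom.IsAlgebraicGL ρ ∧ v ≠ 0 ∧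
      ∀ g : ↥G, (∃ c : k, Matrix.mulVec ((ρ g : GL (Fin N) k) : Matrix (Fin N) (Fin N) k) v = c • v) ↔
        (g : GL n k) ∈ H := by
  obtain ⟨N, ρ, P, v, hP, hv, hstab⟩ := exists_rep_lineStabilizer_eq H hH
  exact ⟨N, ρ.comp G.subtype, v, ⟨P, fun g c => hP g c⟩, hv, fun g => hstab g⟩

end Chevalley

end Literature.NumberTheory.Automorphic
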